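import Summits.Ventures.HodgeRepro2.T5SU11WendelGammaRatio

/-!
# Gautschi's inequality and the two-shift Gamma-ratio asymptotic

Two companions of Wendel's inequalities (`T5SU11WendelGammaRatio`). **Gautschi's inequality**
(W. Gautschi, *Some elementary inequalities relating to the gamma and incomplete gamma function*,
J. Math. Phys. 38 (1959) 77–81): for `x > 0` and `0 ≤ s ≤ 1`,

  **`x^{1−s} ≤ Γ(x + 1)/Γ(x + s) ≤ (x + s)^{1−s} ≤ (x + 1)^{1−s}`**

(`Gamma_add_one_div_ge`, `Gamma_add_one_div_le`, `Gamma_add_one_div_le'`) — the lower half is Wendel's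
upper half and the upper half is Wendel's lower half at the point `x + s`, both being Mathlib's
log-convexity of `Γ`. And the **two-shift asymptotic** `Γ(x + s)/Γ(x + t) ∼ x^{s−t}`:
`Γ(x + s)/(x^{s−t} Γ(x + t)) → 1` as `x → ∞` for all real `s, t` (`tendsto_Gamma_ratio_div`), the quotient of
two one-shift limits. Nothing is claimed about (N).

Blind lane: Mathlib + the HodgeRepro2 prefix only; no sorry; axioms ⊆ {propext, Classical.choice,
Quot.sound}.
-/

namespace Summit.Ventures.HodgeRepro2.T5SU11GautschiGammaRatio

open Filter Topology Set
open T5SU11WendelGammaRatio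
open scoped Real

/-- **Gautschi, lower half**: `x^{1−s} ≤ Γ(x + 1)/Γ(x + s)` for `x > 0`, `0 ≤ s ≤ 1`. -/
theorem Gamma_add_one_div_ge {x s : ℝ} (hx : 0 < x) (hs0 : 0 ≤ s) (hs1 : s ≤ 1) :
    x ^ (1 - s) ≤ Real.Gamma (x + 1) / Real.Gamma (x + s) := by
  have hxs : 0 < x + s := by linarith
  have h := Gamma_add_le hx hs0 hs1
  rw [le_div_iff₀ (Real.Gamma_pos_of_pos hxs), Real.Gamma_add_one hx.ne']
  calc x ^ (1 - s) * Real.Gamma (x + s) ≤ x ^ (1 - s) * (x ^ s * Real.Gamma x) := by gcongr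
    _ = x * Real.Gamma x := by
        rw [← mul_assoc, ← Real.rpow_add hx, sub_add_cancel, Real.rpow_one]

/-- **Gautschi, upper half (Wendel's form)**: `Γ(x + 1)/Γ(x + s) ≤ (x + s)^{1−s}` for `x > 0`, `0 ≤ s ≤ 1`. -/
theorem Gamma_add_one_div_le {x s : ℝ} (hx : 0 < x) (hs0 : 0 ≤ s) (hs1 : s ≤ 1) :
    Real.Gamma (x + 1) / Real.Gamma (x + s) ≤ (x + s) ^ (1 - s) := by
  have hxs : 0 < x + s := by linarith
  have h := Gamma_add_ge hx hs0 hs1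
  rw [div_le_iff₀ (Real.Gamma_pos_of_pos hxs), Real.Gamma_add_one hx.ne']
  exact h

/-- **Gautschi's inequality as printed**: `Γ(x + 1)/Γ(x + s) ≤ (x + 1)^{1−s}`. -/
theorem Gamma_add_one_div_le' {x s : ℝ} (hx : 0 < x) (hs0 : 0 ≤ s) (hs1 : s ≤ 1) :
    Real.Gamma (x + 1) / Real.Gamma (x + s) ≤ (x + 1) ^ (1 - s) :=
  (Gamma_add_one_div_le hx hs0 hs1).trans
    (Real.rpow_le_rpow (by linarith) (by linarith) (by linarith))

/-- **The two-shift asymptotic**: `Γ(x + s)/(x^{s−t} Γ(x + t)) → 1` as `x → ∞`, for all real `s, t`. -/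
theorem tendsto_Gamma_ratio_div (s t : ℝ) :
    Tendsto (fun x : ℝ => Real.Gamma (x + s) / (x ^ (s - t) * Real.Gamma (x + t))) atTop (𝓝 1) := by
  have h := (tendsto_Gamma_ratio s).div (tendsto_Gamma_ratio t) one_ne_zero
  rw [div_one] at h
  refine h.congr' ?_
  filter_upwards [eventually_gt_atTop (0 : ℝ), eventually_gt_atTop (-t)] with x hx hxt
  have hG : Real.Gamma x ≠ 0 := (Real.Gamma_pos_of_pos hx).ne'
  have hGt : Real.Gamma (x + t) ≠ 0 := (Real.Gamma_pos_of_pos (by linarith)).ne'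
  have hs : x ^ s ≠ 0 := (Real.rpow_pos_of_pos hx _).ne'
  have ht : x ^ t ≠ 0 := (Real.rpow_pos_of_pos hx _).ne'
  simp only [Pi.div_apply]
  rw [Real.rpow_sub hx]
  field_simp

end Summit.Ventures.HodgeRepro2.T5SU11GautschiGammaRatio
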